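import Mathlib
import Summits.ResolutionOfSingularities.ResolutionOfSingularities.Theorems.RadicialJungCleanModelsCleanLU3CompositeResidue
import Summits.ResolutionOfSingularities.ResolutionOfSingularities.Theorems.RadicialJungCleanModelsCleanLU3CompositeGlueOne
import Summits.ResolutionOfSingularities.ResolutionOfSingularities.Theorems.RadicialJungCleanModelsCleanLU3CompositeFormOneLift
import Literature.AlgebraicGeometry.Resolution.RegularLocalRingsQuotient
import Literature.AlgebraicGeometry.Resolution.FormalBranchDescent
import HarnessLib

/-!
# Route `RadicialJung`, crux `CleanModels` (stmt-15917), stub `stub_cleanLU3DefectNonDiscrete`, sub-line (C-div): the RESIDUE FRAME —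
# the surface model `Ā ⊆ Ō ⊆ κ(O₁)` under the frame, regular of dimension two

Line `Sketch` rev 24 of crux stmt-ResolutionOfSingularities-15917; lead `res-B-lead-1` g4 (workfile `Lines/Sketch_Cdiv_assembly.lean` v2,
piece RESIDUE FRAME).  OURS; nothing here proves resolution in characteristic `p`.

Setting (output of ✓ `exists_frame_of_coarsening`): `A₁ ⊆ O` a finitely generated `k`-model, `R := locAtCentre A₁ O` regular local of
dimension `3` with regular system of parameters `(t, t₂, t₃)`, `v₁ t < 1`, and `O ≤ O₁` a coarsening which IS the local ring of `R` at its
centre (`locAtCentre R O₁ = O₁`).  With `κ₁ := ResidueField O₁` made a `k`-algebra compatibly with `k → K → O₁ → κ₁`, and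
`Ō := residueValuationSubring O O₁`: the image `Ā` of `A₁` is a finitely generated `k`-subalgebra of `κ₁` inside `Ō` with `Frac Ā = κ₁`
(`exists_residueModel`), every centre of `Ō` above `Ā` is a closed point (`residue_centres_isMaximal`), and its local ring at the centre of
`Ō` is the image of `R`, i.e. `R/(t)`, regular of dimension `2` (`residueFrame`): the residue map `R ↠ locAtCentre Ā Ō` has kernel `tR`
(primality of `t` + ✓ `valuation_eq_one_of_not_dvd`).  This is exactly the input of the delegable stub `stub_cleanLU2` of the workfile.
-/

noncomputable section

set_option linter.dupNamespace false -- mandated namespace of this single-conjunct summit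

open IsLocalRing
open Literature.AlgebraicGeometry.Resolution

namespace Summit.ResolutionOfSingularities.ResolutionOfSingularities.Theorems.RadicialJung.CleanModels

variable {K : Type} [Field K] {k : Type} [Field k] [Algebra k K]

/-- **The residue model**: the image of a `k`-subalgebra `A₁ ⊆ O₁` in `κ₁ = O₁/𝔪₁` is a `k`-subalgebra `Ā` (for a compatible
`k`-algebra structure on `κ₁`), finitely generated if `A₁` is. [folklore] -/
theorem exists_residueModel (O₁ : ValuationSubring K) (A₁ : Subalgebra k K) (hA₁O₁ : A₁.toSubring ≤ O₁.toSubring)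
    [Algebra k (ResidueField O₁)]
    (hcompat : ∀ c : k, algebraMap k (ResidueField O₁) c = residue O₁ ⟨algebraMap k K c, hA₁O₁ (A₁.algebraMap_mem c)⟩) :
    ∃ Ā : Subalgebra k (ResidueField O₁),
      Ā.toSubring = (A₁.toSubring.comap O₁.toSubring.subtype).map (residue O₁) ∧ (A₁.FG → Ā.FG) := by
  -- the residue map on `A₁` as a `k`-algebra map
  let φ : A₁ →ₐ[k] ResidueField O₁ :=
    { toFun := fun a => residue O₁ ⟨(a : K), hA₁O₁ a.2⟩
      map_one' := by rw [← map_one (residue O₁)]; rfl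
      map_mul' := fun a b => by rw [← map_mul]; rfl
      map_zero' := by rw [← map_zero (residue O₁)]; rfl
      map_add' := fun a b => by rw [← map_add]; rfl
      commutes' := fun c => by
        rw [hcompat c]
        rfl }
  refine ⟨φ.range, ?_, fun hfg => ?_⟩
  · ext s
    rw [mem_residueImage_iff O₁ A₁.toSubring hA₁O₁]
    change s ∈ φ.range ↔ _
    rw [AlgHom.mem_range]
    constructor
    · rintro ⟨a, rfl⟩; exact ⟨(a : K), a.2, rfl⟩
    · rintro ⟨x, hx, rfl⟩; exact ⟨⟨x, hx⟩, rfl⟩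
  · rw [← Algebra.map_top]
    exact ((Subalgebra.fg_top A₁).mpr hfg).map φ

/-- **Centres of `Ō` above the residue model are closed points** (transfer of `hzd`): if every subring `T` with `A₁ ⊆ T ⊆ O` has
maximal centre, then every subring `T̄` with `im A₁ ⊆ T̄ ⊆ Ō` has maximal centre — `T̄` is the image of `T := {x ∈ O | res x ∈ T̄}`
and the centre pulls back to the centre. [folklore] -/
theorem residue_centres_isMaximal (O O₁ : ValuationSubring K) (h : O ≤ O₁) (A₁ : Subring K) (hA₁O : A₁ ≤ O.toSubring)
    (hzd : ∀ (T : Subring K) (hT : T ≤ O.toSubring), A₁ ≤ T → (subringCentre T O hT).IsMaximal)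
    (Tb : Subring (ResidueField O₁)) (hTb : Tb ≤ (residueValuationSubring O O₁ h).toSubring)
    (hATb : (A₁.comap O₁.toSubring.subtype).map (residue O₁) ≤ Tb) :
    (subringCentre Tb (residueValuationSubring O O₁ h) hTb).IsMaximal := by
  have hA₁O₁ : A₁ ≤ O₁.toSubring := fun x hx => h (hA₁O hx)
  -- the pulled-back ring `T`
  let T : Subring K :=
    { carrier := {x | ∃ hx : x ∈ O, residue O₁ ⟨x, h hx⟩ ∈ Tb}
      mul_mem' := by
        rintro a b ⟨ha, ha'⟩ ⟨hb, hb'⟩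
        refine ⟨mul_mem ha hb, ?_⟩
        have : residue O₁ ⟨a * b, h (mul_mem ha hb)⟩ = residue O₁ ⟨a, h ha⟩ * residue O₁ ⟨b, h hb⟩ := by
          rw [← map_mul]; rfl
        rw [this]; exact Tb.mul_mem ha' hb'
      one_mem' := ⟨O.one_mem, by rw [show (⟨(1 : K), h O.one_mem⟩ : O₁) = 1 from rfl, map_one]; exact Tb.one_mem⟩
      add_mem' := by
        rintro a b ⟨ha, ha'⟩ ⟨hb, hb'⟩
        refine ⟨add_mem ha hb, ?_⟩
        have : residue O₁ ⟨a + b, h (add_mem ha hb)⟩ = residue O₁ ⟨a, h ha⟩ + residue O₁ ⟨b, h hb⟩ := by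
          rw [← map_add]; rfl
        rw [this]; exact Tb.add_mem ha' hb'
      zero_mem' := ⟨O.zero_mem, by rw [show (⟨(0 : K), h O.zero_mem⟩ : O₁) = 0 from rfl, map_zero]; exact Tb.zero_mem⟩
      neg_mem' := by
        rintro a ⟨ha, ha'⟩
        refine ⟨neg_mem ha, ?_⟩
        have : residue O₁ ⟨-a, h (neg_mem ha)⟩ = -residue O₁ ⟨a, h ha⟩ := by
          rw [← map_neg]; rfl
        rw [this]; exact Tb.neg_mem ha' }
  have hTO : T ≤ O.toSubring := fun x hx => hx.1
  have hA₁T : A₁ ≤ T := fun x hx => ⟨hA₁O hx, hATb (residue_mem_residueImage O₁ A₁ hA₁O₁ hx)⟩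
  have hmax := hzd T hTO hA₁T
  -- the residue map `ψ : T → T̄`
  let ψ : T →+* Tb :=
    { toFun := fun x => ⟨residue O₁ ⟨(x : K), h x.2.1⟩, x.2.2⟩
      map_one' := Subtype.ext (by
        change residue O₁ ⟨((1 : T) : K), _⟩ = 1
        rw [← map_one (residue O₁)]; rfl)
      map_mul' := fun a b => Subtype.ext (by
        change residue O₁ ⟨((a * b : T) : K), _⟩ = residue O₁ _ * residue O₁ _
        rw [← map_mul]; rfl)
      map_zero' := Subtype.ext (by
        change residue O₁ ⟨((0 : T) : K), _⟩ = 0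
        rw [← map_zero (residue O₁)]; rfl)
      map_add' := fun a b => Subtype.ext (by
        change residue O₁ ⟨((a + b : T) : K), _⟩ = residue O₁ _ + residue O₁ _
        rw [← map_add]; rfl) }
  have hψ : Function.Surjective ψ := by
    rintro ⟨s, hs⟩
    obtain ⟨⟨x, hx⟩, hxs⟩ := (mem_residueValuationSubring_iff O O₁ h s).mp (hTb hs)
    have hxs' : residue O₁ ⟨x, h hx⟩ = s := hxs
    refine ⟨⟨x, hx, by rw [hxs']; exact hs⟩, Subtype.ext hxs'⟩
  -- the centre of `(residueValuationSubring O O₁ h)` on `T̄` pulls back to the centre of `O` on `T`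
  have hcomap : (subringCentre Tb (residueValuationSubring O O₁ h) hTb).comap ψ = subringCentre T O hTO := by
    ext x
    rw [Ideal.mem_comap, subringCentre, subringCentre, Ideal.mem_comap, Ideal.mem_comap]
    change (⟨residue O₁ ⟨(x : K), _⟩, hTb x.2.2⟩ : (residueValuationSubring O O₁ h)) ∈ maximalIdeal (residueValuationSubring O O₁ h) ↔ (⟨(x : K), hTO x.2⟩ : O) ∈ maximalIdeal O
    rw [(residueValuationSubring O O₁ h).valuation_lt_one_iff, O.valuation_lt_one_iff]
    exact residue_valuation_lt_one_iff O O₁ h x.2.1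
  have hJ : subringCentre Tb (residueValuationSubring O O₁ h) hTb = Ideal.map ψ (subringCentre T O hTO) := by
    rw [← hcomap, Ideal.map_comap_of_surjective ψ hψ]
  rcases Ideal.map_eq_top_or_isMaximal_of_surjective ψ hψ hmax with htop | hm
  · exfalso
    have hprime : (subringCentre Tb (residueValuationSubring O O₁ h) hTb).IsPrime := by
      rw [subringCentre_eq]; infer_instance
    exact hprime.ne_top (hJ.trans htop)
  · rwa [← hJ] at hm

/-- **The residue frame.**  Under the frame of ✓ `exists_frame_of_coarsening` (`A₁ ⊆ O` a finitely generated `k`-model, `R = locAtCentre A₁ O`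
regular of dimension `3`, every centre above `A₁` closed, `locAtCentre R O₁ = O₁`, and a regular system of parameters `(t, t₂, t₃)` of `R`
with `v₁ t < 1`), and a compatible `k`-algebra structure on `κ₁ = ResidueField O₁`: there is a finitely generated `k`-subalgebra `Ā` of
`κ₁` inside `Ō = residueValuationSubring O O₁` — the image of `A₁` — with `Frac Ā = κ₁`, all centres of `Ō` above `Ā` closed, and whose
local ring at the centre of `Ō` is the image of `R` and is regular of dimension `2` (it is `R/(t)`). [folklore] -/
theorem residueFrame (O O₁ : ValuationSubring K) (hOO₁ : O ≤ O₁)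
    (A₁ : Subalgebra k K) (hA₁O : A₁.toSubring ≤ O.toSubring) (hA₁fg : A₁.FG)
    (hreg : IsRegularLocalRing (locAtCentre A₁.toSubring O))
    (hdim3 : ringKrullDim (locAtCentre A₁.toSubring O) = 3)
    (hzd : ∀ (T : Subring K) (hT : T ≤ O.toSubring), A₁.toSubring ≤ T → (subringCentre T O hT).IsMaximal)
    (hloc : locAtCentre (locAtCentre A₁.toSubring O) O₁ = O₁.toSubring)
    (t t₂ t₃ : K) (ht : t ∈ locAtCentre A₁.toSubring O) (ht₂ : t₂ ∈ locAtCentre A₁.toSubring O)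
    (ht₃ : t₃ ∈ locAtCentre A₁.toSubring O)
    (hmax : (haveI := isLocalRing_locAtCentre hA₁O; maximalIdeal (locAtCentre A₁.toSubring O)) =
      Ideal.span {⟨t, ht⟩, ⟨t₂, ht₂⟩, ⟨t₃, ht₃⟩})
    (hvt : O₁.valuation t < 1)
    [Algebra k (ResidueField O₁)]
    (hcompat : ∀ c : k, algebraMap k (ResidueField O₁) c =
      residue O₁ ⟨algebraMap k K c, hOO₁ (hA₁O (A₁.algebraMap_mem c))⟩) :
    ∃ Ā : Subalgebra k (ResidueField O₁),
      Ā.toSubring = (A₁.toSubring.comap O₁.toSubring.subtype).map (residue O₁) ∧ Ā.FG ∧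
      ∃ (_ : Ā.toSubring ≤ (residueValuationSubring O O₁ hOO₁).toSubring),
      IsFractionRing Ā (ResidueField O₁) ∧
      (∀ (T : Subring (ResidueField O₁)) (hT : T ≤ (residueValuationSubring O O₁ hOO₁).toSubring), Ā.toSubring ≤ T →
        (subringCentre T (residueValuationSubring O O₁ hOO₁) hT).IsMaximal) ∧
      locAtCentre Ā.toSubring (residueValuationSubring O O₁ hOO₁) =
        ((locAtCentre A₁.toSubring O).comap O₁.toSubring.subtype).map (residue O₁) ∧
      IsRegularLocalRing (locAtCentre Ā.toSubring (residueValuationSubring O O₁ hOO₁)) ∧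
      ringKrullDim (locAtCentre Ā.toSubring (residueValuationSubring O O₁ hOO₁)) = 2 ∧
      (∀ (r : K) (hr : r ∈ locAtCentre A₁.toSubring O), residue O₁ ⟨r, hOO₁ (locAtCentre_le hA₁O hr)⟩ = 0 ↔
        O₁.valuation r < 1) := by
  classical
  set Ō := residueValuationSubring O O₁ hOO₁ with hŌdef
  set R : Subring K := locAtCentre A₁.toSubring O with hRdef
  haveI := hreg
  have hRO : R ≤ O.toSubring := locAtCentre_le hA₁O
  have hRO₁ : R ≤ O₁.toSubring := fun x hx => hOO₁ (hRO hx)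
  have hA₁O₁ : A₁.toSubring ≤ O₁.toSubring := fun x hx => hOO₁ (hA₁O hx)
  have hloc' : O₁.toSubring ≤ locAtCentre R O₁ := hloc.symm.le
  -- the model
  obtain ⟨Ā, hĀim, hĀfg⟩ := exists_residueModel O₁ A₁ hA₁O₁ hcompat
  have hĀŌ : Ā.toSubring ≤ Ō.toSubring := by rw [hĀim]; exact residueImage_le O O₁ hOO₁ A₁.toSubring hA₁O
  -- the regular system of parameters and the prime `t`
  have hd3 : (maximalIdeal R).spanFinrank = 3 := spanFinrank_eq_three_of_dim R hdim3
  let x : Fin 3 → R := ![⟨t, ht⟩, ⟨t₂, ht₂⟩, ⟨t₃, ht₃⟩]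
  have hx : Ideal.span (Set.range x) = maximalIdeal R := by rw [range_vec3]; exact hmax.symm
  have hxr : IsRsopPart x := isRsopPart_comp_of_rsop hd3 x hx id Function.injective_id
  have htprime : Prime (x 0) := hxr.prime 0
  have htR : (x 0 : R) = ⟨t, ht⟩ := rfl
  have hvt' : O₁.valuation ((x 0 : R) : K) < 1 := hvt
  have ht2 : (x 0 : R) ∉ maximalIdeal R ^ 2 :=
    not_mem_sq_of_rsop x hx (by rw [hdim3]; rfl) 0
  have htm : (x 0 : R) ∈ maximalIdeal R := hx ▸ Ideal.subset_span ⟨0, rfl⟩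
  -- kernel of the residue map on `R`
  have hker : ∀ (r : K) (hr : r ∈ R), residue O₁ ⟨r, hRO₁ hr⟩ = 0 ↔ O₁.valuation r < 1 := by
    intro r hr
    rw [residue_eq_zero_iff, ValuationSubring.valuation_lt_one_iff]
  have hker' : ∀ r : R, O₁.valuation (r : K) < 1 ↔ x 0 ∣ r := by
    intro r
    constructor
    · intro hlt
      by_contra hnd
      have := valuation_eq_one_of_not_dvd O₁ R hRO₁ hloc' (x 0) htprime hvt' r hnd
      rw [this] at hlt; exact lt_irrefl _ hlt
    · rintro ⟨c, hc⟩
      have hcle : O₁.valuation ((c : R) : K) ≤ 1 := (O₁.valuation_le_one_iff _).mpr (hRO₁ c.2)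
      have : (r : K) = ((x 0 : R) : K) * ((c : R) : K) := by rw [hc]; rfl
      rw [this, map_mul]
      calc O₁.valuation ((x 0 : R) : K) * O₁.valuation ((c : R) : K) ≤ O₁.valuation ((x 0 : R) : K) * 1 := by gcongr
        _ < 1 := by rw [mul_one]; exact hvt'
  -- the residue map `R → κ₁`
  let ρ : R →+* ResidueField O₁ :=
    { toFun := fun r => residue O₁ ⟨(r : K), hRO₁ r.2⟩
      map_one' := by rw [← map_one (residue O₁)]; rfl
      map_mul' := fun a b => by rw [← map_mul]; rfl
      map_zero' := by rw [← map_zero (residue O₁)]; rfl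
      map_add' := fun a b => by rw [← map_add]; rfl }
  have hρrange : ρ.range = (R.comap O₁.toSubring.subtype).map (residue O₁) := by
    ext s
    rw [RingHom.mem_range, mem_residueImage_iff O₁ R hRO₁]
    constructor
    · rintro ⟨r, rfl⟩; exact ⟨(r : K), r.2, rfl⟩
    · rintro ⟨y, hy, rfl⟩; exact ⟨⟨y, hy⟩, rfl⟩
  have hρker : RingHom.ker ρ = Ideal.span {x 0} := by
    ext r
    rw [RingHom.mem_ker, Ideal.mem_span_singleton]
    change residue O₁ ⟨(r : K), hRO₁ r.2⟩ = 0 ↔ _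
    rw [hker (r : K) r.2, hker' r]
  -- `S̄ := locAtCentre Ā Ō` is the image of `R`
  have hS : locAtCentre Ā.toSubring Ō = (R.comap O₁.toSubring.subtype).map (residue O₁) := by
    rw [hĀim, hRdef]; exact (residueImage_locAtCentre O O₁ hOO₁ A₁.toSubring hA₁O).symm
  -- `R/(t) ≃ S̄`
  have hquot := IsRegularLocalRing.quotient_span_singleton htm ht2
  let e : (R ⧸ Ideal.span {x 0}) ≃+* locAtCentre Ā.toSubring Ō :=
    ((Ideal.quotEquivOfEq hρker.symm).trans (RingHom.quotientKerEquivRange ρ)).trans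
      (RingEquiv.subringCongr (hρrange.trans hS.symm))
  haveI : IsRegularLocalRing (R ⧸ Ideal.span {x 0}) := hquot.1
  have hregS : IsRegularLocalRing (locAtCentre Ā.toSubring Ō) := IsRegularLocalRing.of_ringEquiv e
  have hdimS : ringKrullDim (locAtCentre Ā.toSubring Ō) = 2 := by
    rw [← ringKrullDim_eq_of_ringEquiv e]
    obtain ⟨n, hn⟩ := exists_nat_cast_eq_ringKrullDim (R := R ⧸ Ideal.span {x 0})
    have h2 := hquot.2
    rw [hn, hdim3] at h2
    have : n + 1 = 3 := by exact_mod_cast h2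
    have hn2 : n = 2 := by omega
    rw [hn, hn2]; rfl
  -- `Frac Ā = κ₁`
  have hfracĀ : IsFractionRing Ā (ResidueField O₁) := by
    apply IsFractionRing.of_field
    intro z
    obtain ⟨x₁, rfl⟩ := residue_surjective z
    have hx₁ : (x₁ : K) ∈ locAtCentre R O₁ := hloc' x₁.2
    obtain ⟨y, hy, w, hw, hvw, hyw⟩ := (mem_locAtCentre_iff (B := R) (O := O₁)).mp hx₁
    obtain ⟨y₁, hy₁, y₂, hy₂, hvy₂, rfl⟩ := (mem_locAtCentre_iff (B := A₁.toSubring) (O := O)).mp hy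
    obtain ⟨w₁, hw₁, w₂, hw₂, hvw₂, rfl⟩ := (mem_locAtCentre_iff (B := A₁.toSubring) (O := O)).mp hw
    -- `x₁ = (y₁ w₂)/(y₂ w₁)`
    have hy₂0 : y₂ ≠ 0 := ne_zero_of_valuation_eq_one hvy₂
    have hw₂0 : w₂ ≠ 0 := ne_zero_of_valuation_eq_one hvw₂
    have hunit : ∀ {z : K}, z ∈ O → O.valuation z = 1 → O₁.valuation z = 1 := by
      intro z hz hvz
      apply le_antisymm ((O₁.valuation_le_one_iff _).mpr (hOO₁ hz))
      have hzinv : z⁻¹ ∈ O := by rw [← O.valuation_le_one_iff, map_inv₀, hvz, inv_one]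
      have : O₁.valuation z⁻¹ ≤ 1 := (O₁.valuation_le_one_iff _).mpr (hOO₁ hzinv)
      rw [map_inv₀] at this
      exact (inv_le_one₀ (zero_lt_iff.mpr ((Valuation.ne_zero_iff _).mpr (ne_zero_of_valuation_eq_one hvz)))).mp this
    have hvw₁ : O₁.valuation w₁ = 1 := by
      have h1 : O₁.valuation (w₁ / w₂) = 1 := hvw
      rw [map_div₀, hunit (hA₁O hw₂) hvw₂, div_one] at h1
      exact h1
    have hvden : O₁.valuation (y₂ * w₁) = 1 := by rw [map_mul, hunit (hA₁O hy₂) hvy₂, hvw₁, one_mul]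
    have hden0 : y₂ * w₁ ≠ 0 := ne_zero_of_valuation_eq_one hvden
    have hnum : y₁ * w₂ ∈ A₁.toSubring := A₁.toSubring.mul_mem hy₁ hw₂
    have hden : y₂ * w₁ ∈ A₁.toSubring := A₁.toSubring.mul_mem hy₂ hw₁
    have hmemĀ : ∀ {a : K} (ha : a ∈ A₁.toSubring), residue O₁ ⟨a, hA₁O₁ ha⟩ ∈ Ā := by
      intro a ha
      change residue O₁ ⟨a, hA₁O₁ ha⟩ ∈ Ā.toSubring
      rw [hĀim]; exact residue_mem_residueImage O₁ A₁.toSubring hA₁O₁ ha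
    refine ⟨⟨_, hmemĀ hnum⟩, ⟨_, hmemĀ hden⟩, ?_⟩
    change residue O₁ x₁ = residue O₁ ⟨y₁ * w₂, _⟩ / residue O₁ ⟨y₂ * w₁, _⟩
    have heq : (x₁ : K) = (y₁ * w₂) / (y₂ * w₁) := by
      rw [hyw]; field_simp
    have hx₁' : x₁ = ⟨(y₁ * w₂) / (y₂ * w₁), by rw [← heq]; exact x₁.2⟩ := Subtype.ext heq
    rw [hx₁']
    have := residue_div_eq O₁ O₁ le_rfl (hA₁O₁ hnum) (hA₁O₁ hden) hvden
    exact this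
  refine ⟨Ā, hĀim, hĀfg hA₁fg, hĀŌ, hfracĀ, ?_, hS, hregS, hdimS, fun r hr => hker r hr⟩
  intro T hT hĀT
  exact residue_centres_isMaximal O O₁ hOO₁ A₁.toSubring hA₁O hzd T hT (hĀim ▸ hĀT)

end Summit.ResolutionOfSingularities.ResolutionOfSingularities.Theorems.RadicialJung.CleanModels

end
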